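import Literature.AlgebraicGeometry.Frobenioids.ArchimedeanSlitTools
import HarnessLib

/-!
# Frobenioids II, Example 3.3 (v): slit morphisms — the `C`-level core of "slit ⇒ FSMI"

Mochizuki, *The geometry of Frobenioids II: poly-Frobenioids*, Kyushu J. Math. **62** (2008)
401–460, §3, Example 3.3 (v), author's text p. 29 [cite: MochizukiFrdII2008, Ex 3.3 (v) p.29]:
"we shall refer to as a slit morphism any morphism of `F` that is obtained as the isotropic hull of an
object of `F` whose angular region is determined by the complement in `S¹` of a single element of `S¹`.
One verifies immediately that slit morphisms … are FSMI-morphisms."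

This file proves the three `C = C₀ ×_{D₀} D`-level facts from which the statements for `F = A, N, R`
follow (`ArchimedeanSlitMorphisms.lean`), for a linear isometric base-isomorphism `φ : X → Y` from a
slit object `X` (angular part `S¹ ∖ {z₀}`) to a naively isotropic `Y`:
* `C.not_isIso_of_slit`: `φ` is not an isomorphism (isotropy would propagate back along `φ⁻¹`);
* `C.exists_fill`: FIBERWISE SURJECTIVITY — every `γ : Z → Y` (isometry of any degree `d`) fits in a
  square `δ_X ≫ φ = δ_Z ≫ γ` with `δ_Z : W → Z` the inclusion of a NARROW sub-object of `Z` (a small arc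
  around a good direction `w`, `wᵈ` avoiding the two directions that `γ` could send onto the slit);
* `C.isIso_or_isIso_of_fac`: IRREDUCIBILITY dichotomy — when `D` is totally epimorphic, in any
  factorisation `β ≫ α = φ` into linear isometries one factor is an isomorphism (the intermediate
  angular part contains `S¹ ∖ {pt}`: it is either `S¹`, and then `α` is invertible, or `S¹ ∖ {pt}`, and
  then `β` is region-bijective hence invertible; the isotropy of `Y` is not even needed); the
  `D`-components are invertible since an epimorphic split monomorphism is an isomorphism.
Twists `σ ∈ Gal(ℂ/ℝ)` act on directions by `z ↦ z^{(−1)^σ}`.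
-/

namespace Literature.AlgebraicGeometry.Frobenioids

open CategoryTheory Complex
open scoped Pointwise

noncomputable section

namespace ArchFrd

/-! ### Twists on directions -/

/-- The angular part of `σ(u)` is `(unitPart u)^{(−1)^σ}` (`σ ∈ Gal(ℂ/ℝ)`: identity or inversion on
`S¹`). [cite: MochizukiFrdII2008, Def 3.1 (ii) p.24] -/
theorem unitPart_galAct_eq_zpow (σ : Bool) (u : ℂˣ) :
    unitPart ℂ (D0.galAct σ u) = unitPart ℂ u ^ ((-1 : ℤ) ^ σ.toNat) := by
  cases σ with
  | false => rw [D0.galAct_false, Bool.toNat_false, pow_zero, zpow_one]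
  | true => rw [unitPart_galAct_true, Bool.toNat_true, pow_one, zpow_neg_one]

/-- The twist on directions is an involution. [cite: MochizukiFrdII2008, Def 3.1 (ii) p.24] -/
theorem zpow_twist_twist (σ : Bool) (z : normOneSubgroup ℂ) :
    (z ^ ((-1 : ℤ) ^ σ.toNat)) ^ ((-1 : ℤ) ^ σ.toNat) = z := by
  cases σ <;> simp

/-- The twist on directions is injective. [cite: MochizukiFrdII2008, Def 3.1 (ii) p.24] -/
theorem zpow_twist_injective (σ : Bool) :
    Function.Injective fun z : normOneSubgroup ℂ => z ^ ((-1 : ℤ) ^ σ.toNat) := fun z₁ z₂ h => by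
  have := congrArg (fun z : normOneSubgroup ℂ => z ^ ((-1 : ℤ) ^ σ.toNat)) h
  simpa only [zpow_twist_twist] using this

/-- Angular parts of elements of a pointwise power lie in the power of the angular part.
[cite: MochizukiFrdII2008, Def 3.1 (iii) p.24] -/
theorem unitPart_mem_dir_pow (A : AngularRegion ℂ) :
    ∀ (n : ℕ) (a : ℂˣ), a ∈ A.carrier ^ (n + 1) → unitPart ℂ a ∈ A.dir ^ (n + 1)
  | 0, a, ha => by
    rw [zero_add, pow_one] at ha ⊢
    exact ha.1
  | n + 1, a, ha => by
    rw [pow_succ] at ha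
    obtain ⟨x, hx, y, hy, rfl⟩ := Set.mem_mul.mp ha
    rw [pow_succ, unitPart_mul]
    exact Set.mul_mem_mul (unitPart_mem_dir_pow A n x hx) hy.1

universe v u

variable {D : Type u} [Category.{v} D] {π : D ⥤ D0}

namespace C

/-- An object of `C` with a slit angular region is complex. [cite: MochizukiFrdII2008, Ex 3.3 (v) p.29] -/
theorem isComplexObj_of_isSlitRegion {X : C π} (h : IsSlitRegion X.fst.region) :
    X.fst.IsComplexObj := by
  obtain ⟨z₀, hz₀⟩ := h
  rcases D0.isReal_or_isComplex X.fst.base with hr | hc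
  · have hiso := X.fst.isIsotropic_of_isReal hr
    have hmem : z₀ ∈ X.fst.region.dir := by
      rw [show X.fst.region.dir = Set.univ from hiso]; trivial
    rw [hz₀] at hmem
    exact absurd rfl hmem
  · exact hc

/-- A slit object admits no isomorphism onto a naively isotropic object (isotropy propagates back).
[cite: MochizukiFrdII2008, Ex 3.3 (v) p.29] -/
theorem not_isIso_of_slit {X Y : C π} (φ : X ⟶ Y) (hY : Y.fst.IsNaivelyIsotropic)
    (hslit : IsSlitRegion X.fst.region) : ¬ IsIso φ := by
  intro h
  obtain ⟨z₀, hz₀⟩ := hslit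
  haveI := CFP.isIso_fst φ
  have hX : X.fst.IsNaivelyIsotropic := C0.isNaivelyIsotropic_of_hom (inv φ.fst) hY
  have hmem : z₀ ∈ X.fst.region.dir := by
    rw [show X.fst.region.dir = Set.univ from hX]; trivial
  rw [hz₀] at hmem
  exact absurd rfl hmem

/-! ### Fiberwise surjectivity -/

/-- **Fiberwise surjectivity, `C`-level core.** [cite: MochizukiFrdII2008, Ex 3.3 (v) p.29] -/
theorem exists_fill {X Y Z : C π} (φ : X ⟶ Y) (γ : Z ⟶ Y) [IsIso φ.snd]
    (hlin : C0.degFr φ.fst = 1)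
    (hisoφ : ‖(C0.scalar φ.fst : ℂ)‖ * X.fst.tip = Y.fst.tip)
    (hslit : IsSlitRegion X.fst.region)
    (hisoγ : ‖(C0.scalar γ.fst : ℂ)‖ * Z.fst.tip ^ (C0.degFr γ.fst : ℕ) = Y.fst.tip) :
    ∃ (W : C π) (δX : W ⟶ X) (δZ : W ⟶ Z), δX ≫ φ = δZ ≫ γ ∧
      PreFrobenioid.IsIsometry (C.toElem π) δX ∧ PreFrobenioid.IsIsometry (C.toElem π) δZ ∧
      C0.degFr δX.fst = C0.degFr γ.fst ∧ C0.degFr δZ.fst = 1 := by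
  obtain ⟨z₀, hz₀⟩ := id hslit
  have hXc : X.fst.IsComplexObj := isComplexObj_of_isSlitRegion hslit
  haveI hb : IsIso (C0.Base φ.fst) := C.isIso_base_fst π φ
  have hYc : Y.fst.IsComplexObj := D0.isComplex_of_iso (C0.Base φ.fst) hXc
  have hZc : Z.fst.IsComplexObj := D0.isComplex_of_hom (C0.Base γ.fst) hYc
  -- data
  set d : ℕ+ := C0.degFr γ.fst with hd
  set β : Z.fst.base ⟶ X.fst.base := C0.Base γ.fst ≫ inv (C0.Base φ.fst) with hβ
  set c := C0.scalar φ.fst with hc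
  set c' := C0.scalar γ.fst with hc'
  set e : ℂˣ := (β.act c)⁻¹ * c' with he
  set eh : normOneSubgroup ℂ := unitPart ℂ e with heh
  have hcpos : 0 < ‖(c : ℂ)‖ := norm_pos_iff.mpr c.ne_zero
  have hnorme : ‖(e : ℂ)‖ = ‖(c : ℂ)‖⁻¹ * ‖(c' : ℂ)‖ := by
    rw [he, Units.val_mul, norm_mul, Units.val_inv_eq_inv_val, norm_inv]
    unfold D0.Hom.act
    rw [D0.norm_galAct]
  have htX : X.fst.tip = ‖(c : ℂ)‖⁻¹ * Y.fst.tip := by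
    rw [← hisoφ, ← mul_assoc, inv_mul_cancel₀ hcpos.ne', one_mul]
  -- a good direction `w ∈ B_Z` and a small arc around it
  obtain ⟨a₀, ha₀, -⟩ := C0.exists_mem_boundary Z.fst.region
  obtain ⟨w, hwB, hw₁, hw₂⟩ := exists_mem_pow_ne Z.fst.region.isOpen_dir ⟨unitPart ℂ a₀, ha₀.1⟩
    d.pos (eh⁻¹ * z₀) (eh⁻¹ * z₀⁻¹)
  have hgood_open : IsOpen {v : normOneSubgroup ℂ | eh * v ≠ z₀ ∧ eh * v ≠ z₀⁻¹} :=
    (isOpen_compl_singleton.preimage (continuous_const_mul eh)).inter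
      (isOpen_compl_singleton.preimage (continuous_const_mul eh))
  have hwgood : w ^ (d : ℕ) ∈ {v : normOneSubgroup ℂ | eh * v ≠ z₀ ∧ eh * v ≠ z₀⁻¹} := by
    refine ⟨fun h => hw₁ ?_, fun h => hw₂ ?_⟩
    · rw [← h, inv_mul_cancel_left]
    · rw [← h, inv_mul_cancel_left]
  obtain ⟨ε₁, hε₁, hε₁π, hsub₁⟩ := exists_arcDir_subset Z.fst.region.isOpen_dir hwB
  obtain ⟨ε₂, hε₂, hε₂π, hsub₂⟩ := exists_arcDir_subset hgood_open hwgood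
  have hdpos : (0 : ℝ) < d := by exact_mod_cast d.pos
  set ε := min ε₁ (ε₂ / d) with hεdef
  have hε : 0 < ε := lt_min hε₁ (div_pos hε₂ hdpos)
  have hεπ : ε < Real.pi := lt_of_le_of_lt (min_le_left _ _) hε₁π
  have hdε : (d : ℝ) * ε ≤ ε₂ := by
    calc (d : ℝ) * ε ≤ d * (ε₂ / d) := mul_le_mul_of_nonneg_left (min_le_right _ _) hdpos.le
      _ = ε₂ := mul_div_cancel₀ _ hdpos.ne'
  have hdεπ : (d : ℝ) * ε ≤ Real.pi := hdε.trans hε₂π.le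
  -- directions of `A_W^d` are good
  have hdirpow : ∀ a : ℂˣ, a ∈ (arcRegion w ε hε hεπ Z.fst.region.tip).carrier ^ (d : ℕ) →
      eh * unitPart ℂ a ≠ z₀ ∧ eh * unitPart ℂ a ≠ z₀⁻¹ := by
    intro a ha
    have hd1 : (d : ℕ) = (d : ℕ).pred + 1 := (Nat.succ_pred_eq_of_pos d.pos).symm
    rw [hd1] at ha
    have hmem := unitPart_mem_dir_pow _ _ a ha
    change unitPart ℂ a ∈ arcDir w ε ^ ((d : ℕ).pred + 1) at hmem
    have hcast : (((d : ℕ).pred : ℝ) + 1) = (d : ℝ) := by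
      have : (((d : ℕ).pred + 1 : ℕ) : ℝ) = ((d : ℕ) : ℝ) := by rw [← hd1]
      push_cast at this; exact this
    have hsub := pow_subset_arcDir_pow w hε.le (d : ℕ).pred (by rw [hcast]; exact hdεπ) hmem
    rw [← hd1, hcast] at hsub
    exact hsub₂ (arcDir_mono _ hdε hsub)
  -- the narrow object `W` and the two arrows
  let W₀ : C0 := ⟨Z.fst.base, arcRegion w ε hε hεπ Z.fst.region.tip,
    fun h => D0.noConfusion (h.symm.trans hZc)⟩
  let W : C π := ⟨W₀, Z.snd, Z.iso⟩
  let ι₀ : W₀ ⟶ Z.fst :=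
    { base := 𝟙 _, degFr := 1, scalar := 1, scalar_mem := one_mem _,
      mapsTo := by
        rw [one_smul, PNat.one_coe, pow_one]
        change W₀.region.carrier ⊆ C0.pullRegion Z.fst (𝟙 Z.fst.base)
        rw [C0.pullRegion_id]
        intro u hu
        exact ⟨hsub₁ (arcDir_mono w (min_le_left _ _) hu.1), hu.2⟩ }
  have hes : e ∈ D0.scalars W₀.base := by
    change e ∈ D0.scalars Z.fst.base
    rw [show Z.fst.base = D0.complex from hZc]; exact Subgroup.mem_top _
  let δ₀ : W₀ ⟶ X.fst :=
    { base := β, degFr := d, scalar := e, scalar_mem := hes,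
      mapsTo := by
        rintro _ ⟨a, ha, rfl⟩
        change e • a ∈ D0.galAct (D0.Hom.twists β) '' X.fst.region.carrier
        refine ⟨D0.galAct (D0.Hom.twists β) (e * a), ⟨?_, ?_⟩, by
          rw [D0.galAct_galAct, smul_eq_mul]⟩
        · -- direction avoids the slit
          obtain ⟨h₁, h₂⟩ := hdirpow a ha
          rw [hz₀, Set.mem_compl_iff, Set.mem_singleton_iff, unitPart_galAct_eq_zpow, unitPart_mul, ← heh]
          rcases Bool.eq_false_or_eq_true (D0.Hom.twists β) with hτ | hτ
          · rw [hτ, Bool.toNat_true, pow_one, zpow_neg_one]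
            intro h
            apply h₂
            rw [← h, inv_inv]
          · rw [hτ, Bool.toNat_false, pow_zero, zpow_one]
            exact h₁
        · -- absolute value at most `tip(A_X)`
          rw [← Subtype.coe_le_coe, coe_absHom, D0.norm_galAct, Units.val_mul, norm_mul, hnorme]
          change ‖(c : ℂ)‖⁻¹ * ‖(c' : ℂ)‖ * ‖(a : ℂ)‖ ≤ X.fst.tip
          rw [htX, mul_assoc]
          refine mul_le_mul_of_nonneg_left ?_ (inv_nonneg.mpr (norm_nonneg _))
          calc ‖(c' : ℂ)‖ * ‖(a : ℂ)‖ ≤ ‖(c' : ℂ)‖ * Z.fst.tip ^ (d : ℕ) :=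
                mul_le_mul_of_nonneg_left
                  (norm_le_of_mem_carrier_pow (arcRegion w ε hε hεπ Z.fst.region.tip) _ a ha :
                    ‖(a : ℂ)‖ ≤ Z.fst.tip ^ (d : ℕ)) (norm_nonneg _)
            _ = Y.fst.tip := hisoγ }
  -- compatibility with the identifications (stated via the base functor `F : C₀ → D₀`)
  haveI hbF : IsIso ((PreFrobenioid.baseFunctor C0.toElem).map φ.fst) := hb
  have φw : (PreFrobenioid.baseFunctor C0.toElem).map φ.fst ≫ Y.iso.hom = X.iso.hom ≫ π.map φ.snd :=
    φ.w
  have γw : (PreFrobenioid.baseFunctor C0.toElem).map γ.fst ≫ Y.iso.hom = Z.iso.hom ≫ π.map γ.snd :=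
    γ.w
  have h1 : inv ((PreFrobenioid.baseFunctor C0.toElem).map φ.fst) ≫ X.iso.hom =
      Y.iso.hom ≫ π.map (inv φ.snd) := by
    rw [IsIso.inv_comp_eq, ← Category.assoc, φw, Category.assoc, ← π.map_comp, IsIso.hom_inv_id,
      CategoryTheory.Functor.map_id, Category.comp_id]
  let δZ : W ⟶ Z := ⟨ι₀, 𝟙 Z.snd, by
    change 𝟙 _ ≫ Z.iso.hom = Z.iso.hom ≫ π.map (𝟙 Z.snd)
    rw [Category.id_comp, CategoryTheory.Functor.map_id, Category.comp_id]⟩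
  let δX : W ⟶ X := ⟨δ₀, γ.snd ≫ inv φ.snd, by
    change ((PreFrobenioid.baseFunctor C0.toElem).map γ.fst ≫
        inv ((PreFrobenioid.baseFunctor C0.toElem).map φ.fst)) ≫ X.iso.hom =
      Z.iso.hom ≫ π.map (γ.snd ≫ inv φ.snd)
    rw [Category.assoc, h1, ← Category.assoc, γw, Category.assoc, ← π.map_comp]⟩
  refine ⟨W, δX, δZ, ?_, ?_, ?_, rfl, rfl⟩
  · -- the square commutes
    refine CFP.hom_ext (C0.hom_ext ?_ ?_ ?_) ?_
    · change β ≫ C0.Base φ.fst = 𝟙 _ ≫ C0.Base γ.fst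
      rw [hβ, Category.assoc, IsIso.inv_hom_id, Category.comp_id, Category.id_comp]
    · change d * C0.degFr φ.fst = 1 * C0.degFr γ.fst
      rw [hlin, mul_one, one_mul]
    · change β.act c * e ^ (C0.degFr φ.fst : ℕ) = D0.Hom.act (𝟙 _) c' * (1 : ℂˣ) ^ (d : ℕ)
      rw [hlin, PNat.one_coe, pow_one, one_pow, mul_one, he, mul_inv_cancel_left]
      unfold D0.Hom.act
      rw [D0.twists_id, D0.galAct_false]
    · change (γ.snd ≫ inv φ.snd) ≫ φ.snd = 𝟙 _ ≫ γ.snd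
      rw [Category.assoc, IsIso.inv_hom_id, Category.comp_id, Category.id_comp]
  · -- `δX` is an isometry: `|e| · t_Z^d = t_X`
    refine (A0.isIsometry_iff_norm_mul_tip_pow δ₀).mpr ?_
    change ‖(e : ℂ)‖ * Z.fst.tip ^ (d : ℕ) = X.fst.tip
    rw [hnorme, htX, mul_assoc, hisoγ]
  · refine (A0.isIsometry_iff_norm_mul_tip_pow ι₀).mpr ?_
    change ‖((1 : ℂˣ) : ℂ)‖ * Z.fst.tip ^ ((1 : ℕ+) : ℕ) = Z.fst.tip
    rw [Units.val_one, norm_one, one_mul, PNat.one_coe, pow_one]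

/-! ### Irreducibility dichotomy -/

/-- In a totally epimorphic category, the first factor of a factorisation of an isomorphism is an
isomorphism (an epimorphic split monomorphism). [cite: MochizukiFrdI2008, §0 p.15] -/
theorem isIso_of_comp_isIso {E : Type*} [Category E] (hE : IsTotallyEpimorphic E) {a m b : E}
    (f : a ⟶ m) (g : m ⟶ b) [IsIso (f ≫ g)] : IsIso f := by
  haveI := hE.epi f
  haveI : IsSplitMono f := IsSplitMono.mk' ⟨g ≫ inv (f ≫ g), by
    rw [← Category.assoc, IsIso.hom_inv_id]⟩
  exact isIso_of_epi_of_isSplitMono f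

/-- **Irreducibility dichotomy, `C`-level core.** [cite: MochizukiFrdII2008, Ex 3.3 (v) p.29] -/
theorem isIso_or_isIso_of_fac (hD : IsTotallyEpimorphic D) {X M Y : C π} (φ : X ⟶ Y) (β : X ⟶ M)
    (α : M ⟶ Y) (hfac : β ≫ α = φ) [IsIso φ.snd] (hslit : IsSlitRegion X.fst.region)
    (hβlin : C0.degFr β.fst = 1) (hβiso : ‖(C0.scalar β.fst : ℂ)‖ * X.fst.tip = M.fst.tip)
    (hαlin : C0.degFr α.fst = 1) (hαiso : ‖(C0.scalar α.fst : ℂ)‖ * M.fst.tip = Y.fst.tip) :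
    IsIso α ∨ IsIso β := by
  obtain ⟨z₀, hz₀⟩ := id hslit
  -- `D`-components
  have hsnd : β.snd ≫ α.snd = φ.snd := congrArg CFP.Hom.snd hfac
  haveI : IsIso (β.snd ≫ α.snd) := by rw [hsnd]; infer_instance
  haveI : IsIso β.snd := isIso_of_comp_isIso hD β.snd α.snd
  haveI : IsIso α.snd := by
    have : α.snd = inv β.snd ≫ φ.snd := by rw [IsIso.eq_inv_comp, hsnd]
    rw [this]; infer_instance
  -- bases: everything is complex
  have hXc : X.fst.IsComplexObj := isComplexObj_of_isSlitRegion hslit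
  haveI : IsIso (C0.Base φ.fst) := C.isIso_base_fst π φ
  have hYc : Y.fst.IsComplexObj := D0.isComplex_of_iso (C0.Base φ.fst) hXc
  have hMc : M.fst.IsComplexObj := D0.isComplex_of_hom (C0.Base α.fst) hYc
  haveI : IsIso (C0.Base β.fst) := D0.isIso_of_isComplex _ hXc hMc
  haveI : IsIso (C0.Base α.fst) := D0.isIso_of_isComplex _ hMc hYc
  by_cases hM : M.fst.IsNaivelyIsotropic
  · -- `α` is a linear isometry out of an isotropic object
    left
    haveI : IsIso α.fst := C0.isIso_of_isIsotropic α.fst hM hαlin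
      (by rw [hαlin, PNat.one_coe, pow_one]; exact hαiso)
    exact CFP.isIso_of_isIso_fst_snd α
  · -- `B_M = S¹ ∖ {p}`: `β` maps the region of `X` onto that of `M`
    right
    set cβ := C0.scalar β.fst with hcβ
    set σ := D0.Hom.twists (C0.Base β.fst) with hσ
    have hcβpos : 0 < ‖(cβ : ℂ)‖ := norm_pos_iff.mpr cβ.ne_zero
    -- every direction `v` with `v^{σ} ≠ ĉ z₀`... i.e. every direction except `p` lies in `B_M`
    have hdir : ∀ u : normOneSubgroup ℂ, u ≠ z₀ →
        (unitPart ℂ cβ * u) ^ ((-1 : ℤ) ^ σ.toNat) ∈ M.fst.region.dir := by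
      intro u hu
      have hx : (u : ℂˣ) * ofPosReal ℂ X.fst.region.tip ∈ X.fst.region.carrier := by
        refine ⟨?_, ?_⟩
        · rw [unitPart_coe_mul_ofPosReal, hz₀]; exact hu
        · exact le_of_eq (Prod.ext_iff.mp ((unitDecomposition ℂ).symm_apply_apply
            (u, X.fst.region.tip))).2
      have hm := β.fst.mapsTo (Set.smul_mem_smul_set (Set.pow_mem_pow hx (n := (C0.degFr β.fst : ℕ))))
      obtain ⟨m, hm, hme⟩ := hm
      have hm' : m = D0.galAct σ (cβ * ((u : ℂˣ) * ofPosReal ℂ X.fst.region.tip) ^ (C0.degFr β.fst : ℕ)) := by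
        rw [← smul_eq_mul, ← hme]; exact (D0.galAct_galAct _ _).symm
      have hdm := hm.1
      rw [hm', hβlin, PNat.one_coe, pow_one, unitPart_galAct_eq_zpow, unitPart_mul,
        unitPart_coe_mul_ofPosReal] at hdm
      exact hdm
    -- the missing direction `p` is not in `B_M` (else `M` would be isotropic)
    have hp : (unitPart ℂ cβ * z₀) ^ ((-1 : ℤ) ^ σ.toNat) ∉ M.fst.region.dir := by
      intro hp
      apply hM
      refine Set.eq_univ_of_forall fun v => ?_
      -- `v = (ĉ u)^σ` with `u := ĉ⁻¹ v^σ`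
      set u : normOneSubgroup ℂ := (unitPart ℂ cβ)⁻¹ * v ^ ((-1 : ℤ) ^ σ.toNat) with hudef
      have hv : v = (unitPart ℂ cβ * u) ^ ((-1 : ℤ) ^ σ.toNat) := by
        rw [hudef, mul_inv_cancel_left, zpow_twist_twist]
      by_cases huz : u = z₀
      · rw [hv, huz]; exact hp
      · rw [hv]; exact hdir u huz
    -- region bijectivity of `β.fst`
    have hreg : C0.scalar β.fst • X.fst.region.carrier = C0.pullRegion M.fst (C0.Base β.fst) := by
      apply Set.Subset.antisymm
      · have := β.fst.mapsTo
        change cβ • X.fst.region.carrier ^ (C0.degFr β.fst : ℕ) ⊆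
          C0.pullRegion M.fst (C0.Base β.fst) at this
        rw [hβlin, PNat.one_coe, pow_one] at this
        exact this
      · rintro _ ⟨m, hm, rfl⟩
        change D0.galAct σ m ∈ cβ • X.fst.region.carrier
        refine ⟨cβ⁻¹ * D0.galAct σ m, ⟨?_, ?_⟩, show cβ • (cβ⁻¹ * D0.galAct σ m) = D0.galAct σ m by
          rw [smul_eq_mul, mul_inv_cancel_left]⟩
        · -- direction `≠ z₀`
          rw [hz₀, Set.mem_compl_iff, Set.mem_singleton_iff, unitPart_mul, unitPart_galAct_eq_zpow]
          intro h
          apply hp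
          have hone : unitPart ℂ (1 : ℂˣ) = 1 := by
            have := unitPart_coe_normOne (1 : normOneSubgroup ℂ)
            rwa [OneMemClass.coe_one] at this
          have h' : unitPart ℂ cβ * z₀ = unitPart ℂ m ^ ((-1 : ℤ) ^ σ.toNat) := by
            rw [← h, ← mul_assoc, ← unitPart_mul, mul_inv_cancel, hone, one_mul]
          rw [h', zpow_twist_twist]
          exact hm.1
        · -- absolute value
          rw [← Subtype.coe_le_coe, coe_absHom, Units.val_mul, norm_mul, D0.norm_galAct,
            Units.val_inv_eq_inv_val, norm_inv]
          have hmn : ‖(m : ℂ)‖ ≤ M.fst.tip := by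
            have := hm.2
            rw [← Subtype.coe_le_coe, coe_absHom] at this
            exact this
          change ‖(cβ : ℂ)‖⁻¹ * ‖(m : ℂ)‖ ≤ X.fst.tip
          rw [← hβiso] at hmn
          calc ‖(cβ : ℂ)‖⁻¹ * ‖(m : ℂ)‖ ≤ ‖(cβ : ℂ)‖⁻¹ * (‖(cβ : ℂ)‖ * X.fst.tip) :=
                mul_le_mul_of_nonneg_left hmn (inv_nonneg.mpr (norm_nonneg _))
            _ = X.fst.tip := by rw [← mul_assoc, inv_mul_cancel₀ hcβpos.ne', one_mul]
    haveI : IsIso β.fst := C0.isIso_of_smul_carrier_eq β.fst hβlin hreg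
    exact CFP.isIso_of_isIso_fst_snd β

end C

end ArchFrd

end

end Literature.AlgebraicGeometry.Frobenioids
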